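import Literature.AlgebraicGeometry.Motives.MixedHodgeStructureTensor
import Literature.AlgebraicGeometry.Motives.MixedHodgeStructureDeligneSplittingUnique
import Literature.AlgebraicGeometry.Motives.MixedHodgeStructureSplitOverR
import HarnessLib

/-!
# Deligne's splitting of a tensor product: `I^{p,q}(H₁ ⊗ H₂) = ⊕_{a+c=p, b+d=q} I^{a,b}(H₁) ⊗ I^{c,d}(H₂)`

Deligne's bigrading is "compatible with … the basic operators of tensor, dual, sub, and quotient"
(Green–Griffiths–Kerr, Prop. (I.C.2) (ii); Cattani–El Zein–Griffiths–Lê, Thm. 7.5.6). The tree's tensor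
product `tensor H₁ H₂` (`Motives/MixedHodgeStructureTensor`) is CONSTRUCTED from the tensor bigrading
`tensorBigrading H₁ H₂ (p,q) = ⊕_{a+c=p, b+d=q} I^{a,b} ⊗ I^{c,d}` via `ofBigrading`, using only the WEAK
congruence `conj J^{p,q} ⊆ J^{q,p} + W_{p+q-1}`; that file does not identify `J` with Deligne's `I^{p,q}` of
`H₁ ⊗ H₂`. Here we close the gap:

* `complexConj_tensorBigrading_le_sup_biSup` — the tensor bigrading satisfies the STRONG congruence
  (7.5.11), `conj J^{p,q} ⊆ J^{q,p} ⊕ ⊕_{r<q, s<p} J^{r,s}`, because each factor does (the tree's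
  `complexConj_deligneI_le_deligneI_sup_biSup`) and bidegrees add;
* hence, by the uniqueness of Deligne's splitting (`eq_deligneI_of_splitting`),
  **`tensor_deligneI : I^{p,q}(H₁ ⊗ H₂) = tensorBigrading H₁ H₂ (p,q)`**, with
  `tensorPiece_le_tensor_deligneI : I^{a,b} ⊗ I^{c,d} ⊆ I^{a+c,b+d}(H₁ ⊗ H₂)`;
* `IsSplitOverR.tensor` — a tensor product of `ℝ`-split mixed Hodge structures is `ℝ`-split.

Everything is proved; no named fact is introduced.

## References

* [GreenGriffithsKerr2012] M. Green, P. Griffiths, M. Kerr, *Mumford–Tate groups and domains* (2012),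
  Prop. (I.C.2) (ii).
* [CattaniElZeinGriffithsLe2014] E. Cattani et al. (eds.), *Hodge Theory* (2014), Thm. 7.5.6 (7.5.11),
  §3.1.1.3 (1), §3.2.2.7.
* [DeligneHodgeII1971] P. Deligne, Théorie de Hodge II, 1.1.12, 1.2.8.
-/

noncomputable section

open scoped TensorProduct

namespace Literature.AlgebraicGeometry.Motives

namespace MixedHodgeStructure

open HodgeStructure (complexConj complexConjOrderIso tensorBaseChange complexConj_comap_map₂_mk)

universe u v

variable {V : Type u} [AddCommGroup V] [Module ℚ V]
variable {V' : Type v} [AddCommGroup V'] [Module ℚ V']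
variable (H₁ : MixedHodgeStructure V) (H₂ : MixedHodgeStructure V')

/-- Pulling back along the reassociation `tensorBaseChange` commutes with suprema. [folklore] -/
private theorem comap_tensorBaseChange_iSup'' {ι : Sort*} (X : ι → Submodule ℂ ((ℂ ⊗[ℚ] V) ⊗[ℂ] (ℂ ⊗[ℚ] V'))) :
    (⨆ i, X i).comap (tensorBaseChange V V' : ℂ ⊗[ℚ] (V ⊗[ℚ] V') →ₗ[ℂ] _) =
      ⨆ i, (X i).comap (tensorBaseChange V V' : ℂ ⊗[ℚ] (V ⊗[ℚ] V') →ₗ[ℂ] _) := by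
  simp only [Submodule.comap_equiv_eq_map_symm, Submodule.map_iSup]

/-- `conj (⊕_S t) = ⊕_S conj t`. [folklore] -/
private theorem complexConj_biSup'' {W₀ : Type*} [AddCommGroup W₀] [Module ℚ W₀] {ι : Type*}
    (t : ι → Submodule ℂ (ℂ ⊗[ℚ] W₀)) (S : Set ι) :
    complexConj (⨆ i ∈ S, t i) = ⨆ i ∈ S, complexConj (t i) := by
  have h := (complexConjOrderIso (V := W₀)).map_iSup₂ fun (i : ι) (_ : i ∈ S) => t i
  simpa only [HodgeStructure.complexConjOrderIso_apply] using h

/-- **The tensor bigrading satisfies the congruence (7.5.11): `conj J^{p,q} ⊆ J^{q,p} ⊕ ⊕_{r<q, s<p} J^{r,s}`**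
— `conj (I^{a,b} ⊗ I^{c,d}) = conj I^{a,b} ⊗ conj I^{c,d} ⊆ (I^{b,a} ⊕ ⊕_{r<b,s<a} I) ⊗ (I^{d,c} ⊕ ⊕_{r<d,s<c} I)`,
and every cross term has both total bidegrees strictly below `(q, p)`.
[cite: CattaniElZeinGriffithsLe2014, Thm. 7.5.6 (7.5.11)] -/
theorem complexConj_tensorBigrading_le_sup_biSup (p q : ℤ) :
    complexConj (tensorBigrading H₁ H₂ (p, q)) ≤
      tensorBigrading H₁ H₂ (q, p) ⊔ ⨆ pq ∈ {pq : ℤ × ℤ | pq.1 < q ∧ pq.2 < p}, tensorBigrading H₁ H₂ pq := by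
  rw [tensorBigrading, complexConj_biSup'']
  refine iSup₂_le fun αβ hαβ => ?_
  obtain ⟨⟨a, b⟩, ⟨c, d⟩⟩ := αβ
  have hg : (a + c, b + d) = (p, q) := hαβ
  simp only [Prod.ext_iff] at hg
  obtain ⟨hp, hq⟩ := hg
  rw [tensorPiece, complexConj_comap_map₂_mk]
  have h₁ : complexConj (H₁.deligneFamily (a, b)) ≤
      ⨆ rs ∈ ({(b, a)} : Set (ℤ × ℤ)) ∪ {rs : ℤ × ℤ | rs.1 < b ∧ rs.2 < a}, H₁.deligneFamily rs := by
    rw [iSup_union, iSup_singleton, deligneFamily_apply, deligneFamily_apply]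
    exact H₁.complexConj_deligneI_le_deligneI_sup_biSup b a
  have h₂ : complexConj (H₂.deligneFamily (c, d)) ≤
      ⨆ rs ∈ ({(d, c)} : Set (ℤ × ℤ)) ∪ {rs : ℤ × ℤ | rs.1 < d ∧ rs.2 < c}, H₂.deligneFamily rs := by
    rw [iSup_union, iSup_singleton, deligneFamily_apply, deligneFamily_apply]
    exact H₂.complexConj_deligneI_le_deligneI_sup_biSup d c
  -- each piece `I^α ⊗ I^β`, `α ∈ T₁`, `β ∈ T₂`, lies in the right-hand side
  have haux : ∀ α ∈ ({(b, a)} : Set (ℤ × ℤ)) ∪ {rs : ℤ × ℤ | rs.1 < b ∧ rs.2 < a},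
      ∀ β ∈ ({(d, c)} : Set (ℤ × ℤ)) ∪ {rs : ℤ × ℤ | rs.1 < d ∧ rs.2 < c},
        tensorPiece H₁ H₂ (α, β) ≤
          tensorBigrading H₁ H₂ (q, p) ⊔ ⨆ pq ∈ {pq : ℤ × ℤ | pq.1 < q ∧ pq.2 < p}, tensorBigrading H₁ H₂ pq := by
    intro α hα β hβ
    have hpiece : tensorPiece H₁ H₂ (α, β) ≤ tensorBigrading H₁ H₂ (α.1 + β.1, α.2 + β.2) :=
      le_biSup (tensorPiece H₁ H₂) (i := (α, β)) rfl
    simp only [Set.mem_union, Set.mem_singleton_iff, Set.mem_setOf_eq, Prod.ext_iff] at hα hβ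
    by_cases hmain : (α.1 = b ∧ α.2 = a) ∧ (β.1 = d ∧ β.2 = c)
    · refine le_sup_of_le_left (hpiece.trans (le_of_eq ?_))
      obtain ⟨⟨h1, h2⟩, h3, h4⟩ := hmain
      congr 1
      rw [Prod.ext_iff]
      simp only
      constructor <;> omega
    · have hlt : α.1 + β.1 < q ∧ α.2 + β.2 < p := by
        rcases hα with hα | hα <;> rcases hβ with hβ | hβ
        · exact absurd ⟨hα, hβ⟩ hmain
        · constructor <;> omega
        · constructor <;> omega
        · constructor <;> omega
      exact le_sup_of_le_right (hpiece.trans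
        (le_biSup (tensorBigrading H₁ H₂) (i := (α.1 + β.1, α.2 + β.2)) hlt))
  refine (Submodule.comap_mono (Submodule.map₂_le_map₂ h₁ h₂)).trans ?_
  simp only [Submodule.map₂_iSup_left, Submodule.map₂_iSup_right, comap_tensorBaseChange_iSup'']
  exact iSup₂_le fun β hβ => iSup₂_le fun α hα => haux α hα β hβ

variable [FiniteDimensional ℚ V] [FiniteDimensional ℚ V']

/-- **Deligne's splitting is compatible with tensor products:
`I^{p,q}(H₁ ⊗ H₂) = ⊕_{a+c=p, b+d=q} I^{a,b}(H₁) ⊗ I^{c,d}(H₂)`** (the tensor bigrading splits `W` and `F`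
of `H₁ ⊗ H₂` — by construction — and satisfies (7.5.11), so it is Deligne's splitting by uniqueness,
`eq_deligneI_of_splitting`). [cite: GreenGriffithsKerr2012, Prop. (I.C.2) (ii)] [cite: CattaniElZeinGriffithsLe2014, Thm. 7.5.6] -/
theorem tensor_deligneI (p q : ℤ) : (tensor H₁ H₂).deligneI p q = tensorBigrading H₁ H₂ (p, q) :=
  (eq_deligneI_of_splitting (tensor H₁ H₂) (tensorBigrading H₁ H₂) (fun n => baseChange_tensorW H₁ H₂ n)
    (fun _ => rfl) (complexConj_tensorBigrading_le_sup_biSup H₁ H₂) p q).symm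

/-- `I^{•,•}(H₁ ⊗ H₂)` as a family is the tensor bigrading. [cite: GreenGriffithsKerr2012, Prop. (I.C.2) (ii)] -/
theorem tensor_deligneFamily : (tensor H₁ H₂).deligneFamily = tensorBigrading H₁ H₂ := by
  funext pq
  rw [deligneFamily_apply, tensor_deligneI]

/-- **`I^{a,b}(H₁) ⊗ I^{c,d}(H₂) ⊆ I^{a+c, b+d}(H₁ ⊗ H₂)`.** [cite: GreenGriffithsKerr2012, Prop. (I.C.2) (ii)]
[cite: CattaniElZeinGriffithsLe2014, §3.1.1.3 (1)] -/
theorem tensorPiece_le_tensor_deligneI (a b c d : ℤ) :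
    tensorPiece H₁ H₂ ((a, b), (c, d)) ≤ (tensor H₁ H₂).deligneI (a + c) (b + d) := by
  rw [tensor_deligneI]
  exact le_biSup (tensorPiece H₁ H₂) (i := ((a, b), (c, d))) rfl

variable {H₁ H₂} in
/-- **A tensor product of mixed Hodge structures split over `ℝ` is split over `ℝ`**
(`conj (I^{a,b} ⊗ I^{c,d}) = I^{b,a} ⊗ I^{d,c}`). [cite: CattaniElZeinGriffithsLe2014, Def. 7.5.7 and §3.2.2.7] -/
theorem IsSplitOverR.tensor (h₁ : H₁.IsSplitOverR) (h₂ : H₂.IsSplitOverR) : (tensor H₁ H₂).IsSplitOverR := by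
  refine isSplitOverR_of_le _ fun p q => ?_
  rw [tensor_deligneI, tensor_deligneI, tensorBigrading, complexConj_biSup'']
  refine iSup₂_le fun αβ hαβ => ?_
  obtain ⟨⟨a, b⟩, ⟨c, d⟩⟩ := αβ
  have hg : (a + c, b + d) = (p, q) := hαβ
  simp only [Prod.ext_iff] at hg
  obtain ⟨hp, hq⟩ := hg
  rw [tensorPiece, complexConj_comap_map₂_mk, deligneFamily_apply, deligneFamily_apply, h₁ a b, h₂ c d]
  exact le_biSup (tensorPiece H₁ H₂) (i := ((b, a), (d, c))) (show (b + d, a + c) = (q, p) by rw [hp, hq])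

end MixedHodgeStructure

end Literature.AlgebraicGeometry.Motives

end
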